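import Mathlib
import HarnessLib
import Summits.NavierStokesRegularity.NavierStokesRegularity.Theorems.AxisTwistDoorAveragedConeLiouville
import Summits.NavierStokesRegularity.NavierStokesRegularity.Theorems.AxisTwistDoorAveragedConeLiouvillePositivityFactC

/-!
# Route `AxisTwistDoor` — crux `AveragedConeLiouville` (stmt-NavierStokesRegularity-26889): the closing theorem of the
# line `lrt_shell` (v8), now conditional on Lei–Ren 2024 ONLY

`averagedConeLiouville_of_leiRen`: the crux `AveragedConeLiouville` — a Type-I ancient Oseen-mild divergence-free
profile of the route's energy class (suitable on the backward slab, weak gradient, `𝐈 < ∞`) with `⟪curl v, e₃⟫ ≥ 0`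
everywhere and CIRCLE-AVERAGED tilt domination on the unit cylinder is NOT backward singular at the apex — GIVEN the
single TYPED LITERATURE FACT `Literature.Analysis.FluidPDE.LeiRen2024_quantitative_regular_shells_cyl` (Lei–Ren,
Adv. Math. 445 (2024) 109654, Thm 2/Rem 8/Prop 9 = Lei–Ren–Tian arXiv:2501.08976 Lemma 2.4; cite item wi-87109), which
is not proved in the tree.  Compared with the v7 closing theorem `averagedConeLiouville_of_facts` (p628780, conditional
on Lei–Ren 2024 AND Nazarov–Ural'tseva 2011), the second hypothesis is DISCHARGED: the classical positivity
propagation `PositivityPropagationFactC` that the line consumed from Nazarov–Ural'tseva is now PROVED in the tree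
(`AveragedConeLiouville.PositivityFactC.positivityPropagationFactC_holds`, by comparison with caloric barriers —
bricks P1 `…PositivityBarrier`, P2 `…PositivityStep`, P3 `…PositivityDensity`, P4 `…PositivityCover`,
P5 `…PositivityChain`; no De Giorgi–Nash–Moser theory, `div b = 0` unused).

The proof is the skeleton of record `Cruxes/AveragedConeLiouville/Lines/lrt_shell.lean` (v8) composed BY NAME from the
landed stubs, exactly as in `averagedConeLiouville_of_facts` with `hPos := positivityPropagationFactC_holds`:
(0) ns-el-k1b `…ProfileZoom.zoomToSlackFree`; (1) ns-ezl-w3 `…CircleSwirl.stub_circleSwirl`; (2) LEAD g0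
`…CircleToolkit.stub_circleToolkit`; (3b) ns-cas-k2 `…ShellBookkeeping.shellFact_of_leiRen_of_core` with ns-in-wu-341
`…ShellCore.shellCore_of_class`; (4) LEAD g2 `…PositivityFactC.positivityPropagationFactC_holds`; (5) LEAD g0
F1/F2/F4 ∘ ns-el-k1b `…ShellBound.stub_shellSupersolution` ∘ ns-in-wu-341 `…HarnackChain.axisHarnackChain`; (6) ns-el-k1b
`…ProfileZoom.stub_regularOfFluxDecay`.

HONEST STATUS: still a CONDITIONAL result (type `LeiRen… → AveragedConeLiouville`); the crux item does not close
`proved` — it is blocked on the single Literature fact `LeiRen2024_quantitative_regular_shells_cyl` (quantitative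
partial regularity = quantitative CKN ε-regularity, an XL port).  WHAT THIS IS NOT: not a proof of Navier–Stokes
regularity (Clay A), not even of the leaf `HalfSpaceWindowDoor.Target`; the route's research crux `TiltDominationLoc`
(26991, XL) is OPEN.
-/

noncomputable section

set_option linter.dupNamespace false

namespace Summit.NavierStokesRegularity.NavierStokesRegularity.Theorems.AxisTwistDoorAveragedConeLiouvilleOfLeiRen

open Summit.NavierStokesRegularity.NavierStokesRegularity.Theorems.AxisTwistDoorAveragedConeLiouvilleDefs
open Summit.NavierStokesRegularity.NavierStokesRegularity.Theorems

/-- **`AveragedConeLiouville` GIVEN Lei–Ren 2024 (quantitative regular shells) ONLY** — closing theorem of the line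
`lrt_shell` (v8) of crux stmt-NavierStokesRegularity-26889; the classical positivity propagation is proved in the tree
(`positivityPropagationFactC_holds`), so Nazarov–Ural'tseva 2011 is no longer a hypothesis.
[conditional on: `LeiRen2024_quantitative_regular_shells_cyl`] -/
theorem averagedConeLiouville_of_leiRen
    (h₁ : Literature.Analysis.FluidPDE.LeiRen2024_quantitative_regular_shells_cyl) :
    Summit.NavierStokesRegularity.NavierStokesRegularity.Theses.AxisTwistDoor.AveragedConeLiouville := by
  intro C v π H hdecay hcont hmild hdiv hsw hwg hI hnn hKM hsing
  obtain ⟨C', v', π', H', ⟨hdecay', hcont', hmild', hdiv'⟩, ⟨hsw', hwg', hI'⟩, hsing', hnn', hK'⟩ :=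
    AveragedConeLiouvilleProfileZoom.zoomToSlackFree C v π H hdecay hcont hmild hdiv hsw hwg hI hnn hKM hsing
  have hcl' : InClass C' v' π' H' := ⟨hdecay', hcont', hmild', hdiv', hsw', hwg', hI'⟩
  have hShell : ShellFact :=
    AveragedConeLiouville.ShellBookkeeping.shellFact_of_leiRen_of_core h₁ AveragedConeLiouville.ShellCore.shellCore_of_class
  have hPos : PositivityPropagationFactC := AveragedConeLiouville.PositivityFactC.positivityPropagationFactC_holds
  have hFlux : FluxDecay v' :=
    AxisTwistDoorAveragedConeLiouvilleRescale.fluxDecay_of_unitContraction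
      (AxisTwistDoorAveragedConeLiouvilleUnitContraction.unitContraction_of AveragedConeLiouville.ShellBound.stub_shellSupersolution
        AveragedConeLiouville.HarnackChain.axisHarnackChain hShell hPos)
      C' v' π' H' hcl' hnn' hK'
  exact AveragedConeLiouvilleProfileZoom.stub_regularOfFluxDecay AveragedConeLiouville.CircleSwirl.stub_circleSwirl
    AxisTwistDoorAveragedConeLiouvilleCircleToolkit.stub_circleToolkit hShell C' v' π' H' hcl' hnn' hK' hFlux hsing'

end Summit.NavierStokesRegularity.NavierStokesRegularity.Theorems.AxisTwistDoorAveragedConeLiouvilleOfLeiRen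

end
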